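import Summits.KontsevichZagierPeriods.KontsevichZagierPeriods.Theorems.RootDecompQuadraticDescentGoldenPairP1

/-!
# DARK census pair #10 `[□²,1/(1−x+y+x²−y²)] ≡ 2·[□²,1/(1+y+2xy+y²)]` DECIDED in `KZ.relations` by rules 1+2 (route `RootDecompQuadraticDescent`, instance of crux stmt-KontsevichZagierPeriods-28994 `DescentTwoQ` / stmt-4280 `KZDimTwo`) · part 2/6

Cell `decomp-kz`, lens 6 (decomp-kz-lens-6 g8e): `pair10` — the golden-ratio dilogarithm pair of the weight-2 box census, decided with ℚ-data only (no power map, no Landen, no irrational cut); packaged `goldenPair_descentTwoQ_instance` (∀ R ⊇ relations) and `goldenPair_of_kzDimTwo` BY NAME over the born `KZDimTwo`; imports the LANDED `…DarkPairsEleven` reflection kit.  After this, the weight-2 box census has ONE open row (#18).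

Source: `HOME/decomp-kz-lens-6/g8/GoldenPair10.lean` sha256 3ad60a9384e30dab (1472 l; critic decomp-kz-crit-1 g2 CLEARED/kernel-confirmed 2026-08-30T10:32:33Z, std axioms), split into 6 modules by the landing seat decomp-kz-census-1 g7 (contexts re-opened per part; generic docstrings added where the source had none; the route file is imported only by the last part).  No `sorry`; standard axioms.  References: [cite: KontsevichZagier2001, §1.2].
-/

noncomputable section

open MeasureTheory Set MvPolynomial

namespace Summit.KontsevichZagierPeriods.RootDecompQuadraticDescent.GoldenPair

open Literature.NumberTheory.Transcendental
open Literature.NumberTheory.Transcendental.KZ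
open Literature.ModelTheory.ExponentialFields (IsSemialgebraic continuous_aeval_real)
open Summit.KontsevichZagierPeriods.RootDecompQuadraticDescent.DarkPairs (rel_reflect_rep rel_double
  update_one_apply_zero one_div_eq_mul_one_div)

-- PRIVATE copy (landed twin elsewhere; dedup.landed): rel_symm, volume_vline
/-- `rel_symm`: auxiliary theorem of the lens-6 g8e development GoldenPair10 (census pair #10; instances of 28994/4280) — see the module docstring; verbatim from the lens file. -/
private theorem rel_symm {a b : KZ.FormalRep} (h : a - b ∈ KZ.relations) : b - a ∈ KZ.relations := by
  have h' := neg_mem h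
  rwa [neg_sub] at h'

/-- The line `{t = q}` in `ℝ²` is null. -/
private theorem volume_vline (q : ℝ) : volume {z : Fin 2 → ℝ | z 0 = q} = 0 :=
  measure_mono_null (fun _ hz => hz)
    (KZ.volume_setOf_init_mem_eq_zero (n := 1) (KZ.volume_setOf_last_eq_zero (n := 0) q))

-- PRIVATE copy (landed twin elsewhere; dedup.landed): snoc2_zero, snoc2_one, init2_zero, last_one_eq, rel_trans
/-- `snoc2_zero`: auxiliary theorem of the lens-6 g8e development GoldenPair10 (census pair #10; instances of 28994/4280) — see the module docstring; verbatim from the lens file. -/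
@[simp] private theorem snoc2_zero (x : Fin 1 → ℝ) (t : ℝ) : (Fin.snoc x t : Fin 2 → ℝ) 0 = x 0 := rfl

/-- `snoc2_one`: auxiliary theorem of the lens-6 g8e development GoldenPair10 (census pair #10; instances of 28994/4280) — see the module docstring; verbatim from the lens file. -/
@[simp] private theorem snoc2_one (x : Fin 1 → ℝ) (t : ℝ) : (Fin.snoc x t : Fin 2 → ℝ) 1 = t := rfl

/-- `init2_zero`: auxiliary theorem of the lens-6 g8e development GoldenPair10 (census pair #10; instances of 28994/4280) — see the module docstring; verbatim from the lens file. -/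
@[simp] private theorem init2_zero (z : Fin 2 → ℝ) : Fin.init z 0 = z 0 := rfl

/-- `last_one_eq`: auxiliary theorem of the lens-6 g8e development GoldenPair10 (census pair #10; instances of 28994/4280) — see the module docstring; verbatim from the lens file. -/
private theorem last_one_eq : (Fin.last 1 : Fin 2) = 1 := rfl

/-- `rel_trans`: auxiliary theorem of the lens-6 g8e development GoldenPair10 (census pair #10; instances of 28994/4280) — see the module docstring; verbatim from the lens file. -/
private theorem rel_trans {a b c : KZ.FormalRep} (h₁ : a - b ∈ KZ.relations) (h₂ : b - c ∈ KZ.relations) :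
    a - c ∈ KZ.relations := by
  have h := add_mem h₁ h₂
  rwa [sub_add_sub_cancel] at h

/-- The part of a lower-edge-`1` band over the sub-interval `[lo, hi] ⊆ [0, 1]` of the base. -/
def vband (lo hi : ℚ) (U : Edge) : Set (Fin 2 → ℝ) :=
  KZlog.band (ivl lo hi) (fun _ => (1 : ℝ)) (fun y => U.onePlus.f (y 0))

/-- `mem_vband`: auxiliary theorem of the lens-6 g8e development GoldenPair10 (census pair #10; instances of 28994/4280) — see the module docstring; verbatim from the lens file. -/
private theorem mem_vband {lo hi : ℚ} {U : Edge} {z : Fin 2 → ℝ} :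
    z ∈ vband lo hi U ↔ ((lo : ℝ) ≤ z 0 ∧ z 0 ≤ hi) ∧ 1 ≤ z 1 ∧ z 1 ≤ 1 + U.f (z 0) := by
  show (Fin.init z ∈ ivl lo hi ∧ (1 : ℝ) ≤ z (Fin.last 1) ∧ z (Fin.last 1) ≤ 1 + U.f (Fin.init z 0)) ↔ _
  rw [mem_ivl]
  rfl

/-- `ivl_subset`: auxiliary theorem of the lens-6 g8e development GoldenPair10 (census pair #10; instances of 28994/4280) — see the module docstring; verbatim from the lens file. -/
theorem ivl_subset {lo hi : ℚ} (hlo : 0 ≤ lo) (hhi : hi ≤ 1) : ivl lo hi ⊆ ivl 0 1 := fun y hy => by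
  rw [mem_ivl] at hy ⊢
  have h1 : ((0 : ℚ) : ℝ) ≤ lo := by exact_mod_cast hlo
  have h2 : ((hi : ℚ) : ℝ) ≤ ((1 : ℚ) : ℝ) := by exact_mod_cast hhi
  exact ⟨h1.trans hy.1, hy.2.trans h2⟩

/-- `isSemialgebraic_vband`: auxiliary theorem of the lens-6 g8e development GoldenPair10 (census pair #10; instances of 28994/4280) — see the module docstring; verbatim from the lens file. -/
private theorem isSemialgebraic_vband (lo hi : ℚ) (hlo : 0 ≤ lo) (hhi : hi ≤ 1) (U : Edge) :
    IsSemialgebraic ℚ (vband lo hi U) :=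
  KZlog.isSemialgebraic_band
    ((isSemialgebraicFunOn_ratCast (isSemialgebraic_ivl lo hi) 1).congr fun y _ => by simp)
    (U.onePlus.sa.mono (ivl_subset hlo hhi) (isSemialgebraic_ivl lo hi))

/-- `vband_subset`: auxiliary theorem of the lens-6 g8e development GoldenPair10 (census pair #10; instances of 28994/4280) — see the module docstring; verbatim from the lens file. -/
theorem vband_subset (lo hi : ℚ) (hlo : 0 ≤ lo) (hhi : hi ≤ 1) (U : Edge) :
    vband lo hi U ⊆ sbDom oneE U.onePlus := fun z hz => by
  rw [mem_vband] at hz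
  rw [mem_sbDom]
  have h1 : ((0 : ℚ) : ℝ) ≤ lo := by exact_mod_cast hlo
  have h2 : ((hi : ℚ) : ℝ) ≤ ((1 : ℚ) : ℝ) := by exact_mod_cast hhi
  push_cast at h1 h2
  exact ⟨⟨h1.trans hz.1.1, hz.1.2.trans h2⟩, by simpa using hz.2.1, by simpa using hz.2.2⟩

/-! ## §4 Generic pieces: polynomial-quotient bands, vertical pieces, open-base null moves, band cuts -/

/-- `abs_div_le_of_le`: auxiliary theorem of the lens-6 g8e development GoldenPair10 (census pair #10; instances of 28994/4280) — see the module docstring; verbatim from the lens file. -/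
private theorem abs_div_le_of_le {c D a : ℝ} (ha : 0 < a) (hD : a ≤ D) : |c / D| ≤ |c| / a := by
  rw [abs_div, abs_of_pos (ha.trans_le hD)]
  exact div_le_div_of_nonneg_left (abs_nonneg c) ha hD

/-- A band representation with integrand `P/Q`, `Q ≥ δ > 0` and `|P| ≤ K` on the band. -/
def BRq (L U : Edge) (P Q : MvPolynomial (Fin 2) ℚ) (δ K : ℝ) (hδ : 0 < δ)
    (hQ : ∀ z ∈ sbDom L U, δ ≤ aeval z Q) (hP : ∀ z ∈ sbDom L U, |aeval z P| ≤ K) :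
    KZ.IntegralRep 2 :=
  BR L U (fun z => aeval z P / aeval z Q)
    (isSemialgebraicFunOn_aeval_div_aeval (isSemialgebraic_sbDom L U) P Q fun z hz =>
      (hδ.trans_le (hQ z hz)).ne')
    ((continuous_aeval_real P).continuousOn.div (continuous_aeval_real Q).continuousOn fun z hz =>
      (hδ.trans_le (hQ z hz)).ne')
    (K / δ) fun z hz => (abs_div_le_of_le hδ (hQ z hz)).trans
      (div_le_div_of_nonneg_right (hP z hz) hδ.le)

/-- `BRq_domain`: auxiliary theorem of the lens-6 g8e development GoldenPair10 (census pair #10; instances of 28994/4280) — see the module docstring; verbatim from the lens file. -/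
@[simp] private theorem BRq_domain (L U : Edge) (P Q δ K hδ hQ hP) :
    (BRq L U P Q δ K hδ hQ hP).domain = sbDom L U := rfl
/-- `BRq_integrand`: auxiliary theorem of the lens-6 g8e development GoldenPair10 (census pair #10; instances of 28994/4280) — see the module docstring; verbatim from the lens file. -/
@[simp] theorem BRq_integrand (L U : Edge) (P Q δ K hδ hQ hP) (z : Fin 2 → ℝ) :
    (BRq L U P Q δ K hδ hQ hP).integrand z = aeval z P / aeval z Q := rfl

/-- The part of a representation on the shifted band `sbDom oneE U.onePlus` over the base sub-interval
`[lo, hi]`. -/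
def VB (R : KZ.IntegralRep 2) (U : Edge) (hR : R.domain = sbDom oneE U.onePlus) (lo hi : ℚ)
    (hlo : 0 ≤ lo) (hhi : hi ≤ 1) : KZ.IntegralRep 2 :=
  R.restrict (vband lo hi U) (isSemialgebraic_vband lo hi hlo hhi U)
    (by rw [hR]; exact vband_subset lo hi hlo hhi U)

/-- `VB_domain`: auxiliary theorem of the lens-6 g8e development GoldenPair10 (census pair #10; instances of 28994/4280) — see the module docstring; verbatim from the lens file. -/
@[simp] private theorem VB_domain (R : KZ.IntegralRep 2) (U : Edge) (hR lo hi hlo hhi) :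
    (VB R U hR lo hi hlo hhi).domain = vband lo hi U := rfl
/-- `VB_integrand`: auxiliary theorem of the lens-6 g8e development GoldenPair10 (census pair #10; instances of 28994/4280) — see the module docstring; verbatim from the lens file. -/
@[simp] theorem VB_integrand (R : KZ.IntegralRep 2) (U : Edge) (hR lo hi hlo hhi) :
    (VB R U hR lo hi hlo hhi).integrand = R.integrand := rfl

/-- **(base cut)** additivity along the vertical line `t = q` (rule 1a). -/
theorem vcut (R : KZ.IntegralRep 2) (U : Edge) (hR : R.domain = sbDom oneE U.onePlus) (q : ℚ)
    (hq0 : 0 ≤ q) (hq1 : q ≤ 1) :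
    KZ.of R - KZ.of (VB R U hR 0 q le_rfl hq1) - KZ.of (VB R U hR q 1 hq0 le_rfl) ∈ KZ.relations := by
  refine KZ.domainAddRel_subset_relations ⟨2, R, VB R U hR 0 q le_rfl hq1, VB R U hR q 1 hq0 le_rfl,
    ?_, ?_, fun z _ => rfl, fun z _ => rfl, rfl⟩
  · rw [hR]
    ext z
    simp only [VB_domain, mem_union, mem_sbDom, mem_vband, oneE_f, Edge.onePlus_f, Rat.cast_zero,
      Rat.cast_one]
    constructor
    · rintro ⟨⟨h0, h0'⟩, h1, h2⟩
      rcases le_total (z 0) (q : ℝ) with h | h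
      · exact Or.inl ⟨⟨h0, h⟩, h1, h2⟩
      · exact Or.inr ⟨⟨h, h0'⟩, h1, h2⟩
    · have hq0' : (0 : ℝ) ≤ q := by exact_mod_cast hq0
      have hq1' : (q : ℝ) ≤ 1 := by exact_mod_cast hq1
      rintro (⟨⟨h0, h0'⟩, h1, h2⟩ | ⟨⟨h0, h0'⟩, h1, h2⟩)
      · exact ⟨⟨h0, h0'.trans hq1'⟩, h1, h2⟩
      · exact ⟨⟨hq0'.trans h0, h0'⟩, h1, h2⟩
  · refine measure_mono_null (fun z hz => ?_) (volume_vline (q : ℝ))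
    have h1 : z ∈ vband 0 q U := hz.1
    have h2 : z ∈ vband q 1 U := hz.2
    rw [mem_vband] at h1 h2
    exact le_antisymm h1.1.2 h2.1.1

/-- The lower / upper pieces of a band representation cut along a middle edge (rule 1a). -/
def loP (R : KZ.IntegralRep 2) (L M U : Edge) (hR : R.domain = sbDom L U)
    (hMU : ∀ t ∈ Icc (0 : ℝ) 1, M.f t ≤ U.f t) : KZ.IntegralRep 2 :=
  R.restrict (sbDom L M) (isSemialgebraic_sbDom L M) (by
    rw [hR]; intro z hz
    obtain ⟨h0, h1, h2⟩ := mem_sbDom.1 hz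
    exact mem_sbDom.2 ⟨h0, h1, h2.trans (hMU _ h0)⟩)

/-- `hiP`: auxiliary def of the lens-6 g8e development GoldenPair10 (census pair #10; instances of 28994/4280) — see the module docstring; verbatim from the lens file. -/
def hiP (R : KZ.IntegralRep 2) (L M U : Edge) (hR : R.domain = sbDom L U)
    (hLM : ∀ t ∈ Icc (0 : ℝ) 1, L.f t ≤ M.f t) : KZ.IntegralRep 2 :=
  R.restrict (sbDom M U) (isSemialgebraic_sbDom M U) (by
    rw [hR]; intro z hz
    obtain ⟨h0, h1, h2⟩ := mem_sbDom.1 hz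
    exact mem_sbDom.2 ⟨h0, (hLM _ h0).trans h1, h2⟩)

/-- `loP_domain`: auxiliary theorem of the lens-6 g8e development GoldenPair10 (census pair #10; instances of 28994/4280) — see the module docstring; verbatim from the lens file. -/
@[simp] theorem loP_domain (R : KZ.IntegralRep 2) (L M U : Edge) (hR hMU) :
    (loP R L M U hR hMU).domain = sbDom L M := rfl
/-- `loP_integrand`: auxiliary theorem of the lens-6 g8e development GoldenPair10 (census pair #10; instances of 28994/4280) — see the module docstring; verbatim from the lens file. -/
@[simp] theorem loP_integrand (R : KZ.IntegralRep 2) (L M U : Edge) (hR hMU) :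
    (loP R L M U hR hMU).integrand = R.integrand := rfl
/-- `hiP_domain`: auxiliary theorem of the lens-6 g8e development GoldenPair10 (census pair #10; instances of 28994/4280) — see the module docstring; verbatim from the lens file. -/
@[simp] theorem hiP_domain (R : KZ.IntegralRep 2) (L M U : Edge) (hR hLM) :
    (hiP R L M U hR hLM).domain = sbDom M U := rfl
/-- `hiP_integrand`: auxiliary theorem of the lens-6 g8e development GoldenPair10 (census pair #10; instances of 28994/4280) — see the module docstring; verbatim from the lens file. -/
@[simp] theorem hiP_integrand (R : KZ.IntegralRep 2) (L M U : Edge) (hR hLM) :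
    (hiP R L M U hR hLM).integrand = R.integrand := rfl

/-- **(band cut)** `[L ≤ σ ≤ U] = [L ≤ σ ≤ M] + [M ≤ σ ≤ U]` (rule 1a). -/
theorem br_cut (R : KZ.IntegralRep 2) (L M U : Edge) (hR : R.domain = sbDom L U)
    (hLM : ∀ t ∈ Icc (0 : ℝ) 1, L.f t ≤ M.f t) (hMU : ∀ t ∈ Icc (0 : ℝ) 1, M.f t ≤ U.f t) :
    KZ.of R - KZ.of (loP R L M U hR hMU) - KZ.of (hiP R L M U hR hLM) ∈ KZ.relations := by
  refine KZ.domainAddRel_subset_relations ⟨2, R, loP R L M U hR hMU, hiP R L M U hR hLM, ?_, ?_,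
    fun z _ => rfl, fun z _ => rfl, rfl⟩
  · rw [hR]
    ext z
    simp only [loP_domain, hiP_domain, mem_union, mem_sbDom]
    constructor
    · rintro ⟨h0, h1, h2⟩
      rcases le_total (z 1) (M.f (z 0)) with h | h
      · exact Or.inl ⟨h0, h1, h⟩
      · exact Or.inr ⟨h0, h, h2⟩
    · rintro (⟨h0, h1, h2⟩ | ⟨h0, h1, h2⟩)
      · exact ⟨h0, h1, h2.trans (hMU _ h0)⟩
      · exact ⟨h0, (hLM _ h0).trans h1, h2⟩
  · refine measure_mono_null (fun z hz => ?_) (KZ.volume_graph_eq_zero M.sa)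
    have h1 : z ∈ sbDom L M := hz.1
    have h2 : z ∈ sbDom M U := hz.2
    refine ⟨h1.1, ?_⟩
    show z (Fin.last 1) = M.f (Fin.init z 0)
    exact le_antisymm h1.2.2 h2.2.1

/-! ### Open base and the null moves -/

/-- `Gopen`: auxiliary def of the lens-6 g8e development GoldenPair10 (census pair #10; instances of 28994/4280) — see the module docstring; verbatim from the lens file. -/
def Gopen : Set (Fin 1 → ℝ) := {y | 0 < y 0 ∧ y 0 < 1}

/-- `isOpen_Gopen`: auxiliary theorem of the lens-6 g8e development GoldenPair10 (census pair #10; instances of 28994/4280) — see the module docstring; verbatim from the lens file. -/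
private theorem isOpen_Gopen : IsOpen Gopen :=
  (isOpen_lt continuous_const (continuous_apply 0)).inter (isOpen_lt (continuous_apply 0) continuous_const)

/-- `Gopen_subset`: auxiliary theorem of the lens-6 g8e development GoldenPair10 (census pair #10; instances of 28994/4280) — see the module docstring; verbatim from the lens file. -/
private theorem Gopen_subset : Gopen ⊆ ivl 0 1 := fun y hy => by
  rw [mem_ivl]; push_cast; exact ⟨hy.1.le, hy.2.le⟩

/-- `isSemialgebraic_Gopen`: auxiliary theorem of the lens-6 g8e development GoldenPair10 (census pair #10; instances of 28994/4280) — see the module docstring; verbatim from the lens file. -/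
private theorem isSemialgebraic_Gopen : IsSemialgebraic ℚ Gopen := by
  have h1 := Literature.ModelTheory.ExponentialFields.isSemialgebraic_setOf_eval_lt (k := ℚ) (R := ℝ)
    (C 0 : MvPolynomial (Fin 1) ℚ) (X 0)
  have h2 := Literature.ModelTheory.ExponentialFields.isSemialgebraic_setOf_eval_lt (k := ℚ) (R := ℝ)
    (X 0 : MvPolynomial (Fin 1) ℚ) (C 1)
  simp only [aeval_X, aeval_C, eq_ratCast, Rat.cast_zero, Rat.cast_one] at h1 h2
  exact h1.inter h2

/-- The open-base part `{0 < t < 1, L(t) ≤ σ ≤ U(t)}` of `sbDom L U`. -/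
def obDom (L U : Edge) : Set (Fin 2 → ℝ) :=
  KZlog.band Gopen (fun y => L.f (y 0)) (fun y => U.f (y 0))

/-- `mem_obDom`: auxiliary theorem of the lens-6 g8e development GoldenPair10 (census pair #10; instances of 28994/4280) — see the module docstring; verbatim from the lens file. -/
private theorem mem_obDom {L U : Edge} {z : Fin 2 → ℝ} :
    z ∈ obDom L U ↔ ((0 : ℝ) < z 0 ∧ z 0 < 1) ∧ L.f (z 0) ≤ z 1 ∧ z 1 ≤ U.f (z 0) := by
  show (Fin.init z ∈ Gopen ∧ L.f (Fin.init z 0) ≤ z (Fin.last 1) ∧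
    z (Fin.last 1) ≤ U.f (Fin.init z 0)) ↔ _
  rfl

/-- `isSemialgebraic_obDom`: auxiliary theorem of the lens-6 g8e development GoldenPair10 (census pair #10; instances of 28994/4280) — see the module docstring; verbatim from the lens file. -/
private theorem isSemialgebraic_obDom (L U : Edge) : IsSemialgebraic ℚ (obDom L U) :=
  KZlog.isSemialgebraic_band (L.sa.mono Gopen_subset isSemialgebraic_Gopen)
    (U.sa.mono Gopen_subset isSemialgebraic_Gopen)

/-- `obDom_subset`: auxiliary theorem of the lens-6 g8e development GoldenPair10 (census pair #10; instances of 28994/4280) — see the module docstring; verbatim from the lens file. -/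
private theorem obDom_subset (L U : Edge) : obDom L U ⊆ sbDom L U := fun z hz => by
  rw [mem_obDom] at hz
  exact mem_sbDom.2 ⟨⟨hz.1.1.le, hz.1.2.le⟩, hz.2⟩

/-- `volume_edges`: auxiliary theorem of the lens-6 g8e development GoldenPair10 (census pair #10; instances of 28994/4280) — see the module docstring; verbatim from the lens file. -/
private theorem volume_edges : volume ({z : Fin 2 → ℝ | z 0 = 0} ∪ {z | z 0 = 1}) = 0 :=
  measure_union_null (volume_vline 0) (volume_vline 1)

/-- `volume_sbDom_diff_obDom`: auxiliary theorem of the lens-6 g8e development GoldenPair10 (census pair #10; instances of 28994/4280) — see the module docstring; verbatim from the lens file. -/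
theorem volume_sbDom_diff_obDom (L U : Edge) : volume (sbDom L U \ obDom L U) = 0 := by
  refine measure_mono_null (fun z hz => ?_) volume_edges
  obtain ⟨hz, hz'⟩ := hz
  obtain ⟨⟨h0, h1⟩, h2, h3⟩ := mem_sbDom.1 hz
  rw [mem_obDom] at hz'
  by_contra h
  simp only [mem_union, mem_setOf_eq, not_or] at h
  exact hz' ⟨⟨lt_of_le_of_ne h0 (Ne.symm h.1), lt_of_le_of_ne h1 h.2⟩, h2, h3⟩

/-- The open-base restriction of a band representation. -/
def OB (R : KZ.IntegralRep 2) (L U : Edge) (hR : R.domain = sbDom L U) : KZ.IntegralRep 2 :=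
  R.restrict (obDom L U) (isSemialgebraic_obDom L U) (by rw [hR]; exact obDom_subset L U)

/-- `OB_domain`: auxiliary theorem of the lens-6 g8e development GoldenPair10 (census pair #10; instances of 28994/4280) — see the module docstring; verbatim from the lens file. -/
@[simp] private theorem OB_domain (R : KZ.IntegralRep 2) (L U : Edge) (hR) :
    (OB R L U hR).domain = obDom L U := rfl
/-- `OB_integrand`: auxiliary theorem of the lens-6 g8e development GoldenPair10 (census pair #10; instances of 28994/4280) — see the module docstring; verbatim from the lens file. -/
@[simp] private theorem OB_integrand (R : KZ.IntegralRep 2) (L U : Edge) (hR) :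
    (OB R L U hR).integrand = R.integrand := rfl

/-- **(null move)** removing the two boundary fibres `t = 0`, `t = 1` (rule 1a with a null piece). -/
private theorem rel_open (R : KZ.IntegralRep 2) (L U : Edge) (hR : R.domain = sbDom L U) :
    KZ.of R - KZ.of (OB R L U hR) ∈ KZ.relations :=
  IntegralRep.of_sub_of_restrict_mem_relations R (isSemialgebraic_obDom L U) _
    (by rw [hR]; exact volume_sbDom_diff_obDom L U)

/-- **(box → band)** the affine fibre substitution `s = 1 + E(t)·σ` from the square onto the shifted
band `{1 ≤ s ≤ 1 + E(t)}`, for an edge `E` positive and differentiable on the OPEN base (it may vanish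
at `t = 0, 1`): rule 2 over the open base (`KZ.of_sub_of_mem_relations_of_affine`) between two null
moves. -/
theorem box_to_band (E : Edge) (hEpos : ∀ t ∈ Ioo (0 : ℝ) 1, 0 < E.f t)
    (hEd : DifferentiableOn ℝ E.f (Ioo 0 1)) (P : RFun 2) (R : KZ.IntegralRep 2)
    (hR : R.domain = sbDom oneE E.onePlus)
    (hint : ∀ z ∈ cube 2, 0 < z 0 → z 0 < 1 →
      P.fn z = R.integrand (Fin.snoc (Fin.init z) (1 + E.f (z 0) * z 1)) * E.f (z 0)) :
    KZ.of P.rep - KZ.of R ∈ KZ.relations := by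
  have hP : P.rep.domain = sbDom zeroE oneE := by rw [RFun.rep_domain, cube_eq_sbDom]
  have h1 := rel_open P.rep zeroE oneE hP
  have h3 := rel_open R oneE E.onePlus hR
  have h2 : KZ.of (OB P.rep zeroE oneE hP) - KZ.of (OB R oneE E.onePlus hR) ∈ KZ.relations := by
    refine of_sub_of_mem_relations_of_affine isOpen_Gopen (α := fun _ => (1 : ℝ))
      (β := fun y => E.f (y 0)) (a := fun y => zeroE.f (y 0)) (b := fun y => oneE.f (y 0))
      (a' := fun y => oneE.f (y 0)) (b' := fun y => E.onePlus.f (y 0)) ?_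
      (E.sa.mono Gopen_subset isSemialgebraic_Gopen) (differentiableOn_const _) ?_
      (fun y hy => hEpos _ ⟨hy.1, hy.2⟩) _ _ rfl rfl (fun y _ => by simp) (fun y _ => by simp)
      fun z hz => ?_
    · simpa using isSemialgebraicFunOn_ratCast isSemialgebraic_Gopen 1
    · exact hEd.comp (fun y _ => (differentiableAt_apply (𝕜 := ℝ) 0 y).differentiableWithinAt)
        fun y hy => ⟨hy.1, hy.2⟩
    · have hz' : z ∈ obDom zeroE oneE := hz
      rw [mem_obDom] at hz'
      have hzc : z ∈ cube 2 := by
        rw [cube_eq_sbDom]; exact obDom_subset zeroE oneE hz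
      rw [OB_integrand, OB_integrand, RFun.rep_integrand, last_one_eq]
      simpa only [init2_zero] using hint z hzc hz'.1.1 hz'.1.2
  exact rel_trans (rel_trans h1 h2) (rel_symm h3)

/-- Linearity in the integrand (rule 1b). -/
private theorem rel_lin (T S U : RFun 2) (h : ∀ x ∈ cube 2, T.fn x = S.fn x + U.fn x) :
    KZ.of T.rep - KZ.of S.rep - KZ.of U.rep ∈ KZ.relations :=
  KZ.cubicalLinGens_subset_relations (KZ.mem_cubicalLinGens T.isTameCube_rep S.isTameCube_rep
    U.isTameCube_rep fun x hx => by simpa using h x hx)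

/-! ### The edges `1 − t`, `t/(1+t)`, `1/(1+t)` -/

/-- `omE`: auxiliary def of the lens-6 g8e development GoldenPair10 (census pair #10; instances of 28994/4280) — see the module docstring; verbatim from the lens file. -/
def omE : Edge := mkEdge (fun t => 1 - t) (1 - X 0) 1 (fun y _ => by simp) (fun y _ => by simp)
  (fun t ht => by linarith [ht.2]) (by fun_prop)
/-- `tqE`: auxiliary def of the lens-6 g8e development GoldenPair10 (census pair #10; instances of 28994/4280) — see the module docstring; verbatim from the lens file. -/
def tqE : Edge := mkEdge (fun t => t / (1 + t)) (X 0) (1 + X 0)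
  (fun y hy => by have := (I01 hy).1; simp only [map_add, map_one, aeval_X]; positivity)
  (fun y _ => by simp) (fun t ht => by have := ht.1; positivity)
  (ContinuousOn.div (by fun_prop) (by fun_prop) fun t ht => by have := ht.1; positivity)
/-- `rE`: auxiliary def of the lens-6 g8e development GoldenPair10 (census pair #10; instances of 28994/4280) — see the module docstring; verbatim from the lens file. -/
def rE : Edge := mkEdge (fun t => 1 / (1 + t)) 1 (1 + X 0)
  (fun y hy => by have := (I01 hy).1; simp only [map_add, map_one, aeval_X]; positivity)
  (fun y _ => by simp) (fun t ht => by have := ht.1; positivity)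
  (ContinuousOn.div (by fun_prop) (by fun_prop) fun t ht => by have := ht.1; positivity)

/-- `omE_f`: auxiliary theorem of the lens-6 g8e development GoldenPair10 (census pair #10; instances of 28994/4280) — see the module docstring; verbatim from the lens file. -/
@[simp] theorem omE_f (t : ℝ) : omE.f t = 1 - t := rfl
/-- `tqE_f`: auxiliary theorem of the lens-6 g8e development GoldenPair10 (census pair #10; instances of 28994/4280) — see the module docstring; verbatim from the lens file. -/
@[simp] theorem tqE_f (t : ℝ) : tqE.f t = t / (1 + t) := rfl
/-- `rE_f`: auxiliary theorem of the lens-6 g8e development GoldenPair10 (census pair #10; instances of 28994/4280) — see the module docstring; verbatim from the lens file. -/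
@[simp] theorem rE_f (t : ℝ) : rE.f t = 1 / (1 + t) := rfl

/-! ## §5 The c-trick: `TΔ(c) = [Δ, dw dv/(1 + c·w·v)] ≡ G(c) = [□², du dσ/((1+u)² + c·u·σ)]` (`|c| ≤ 1`)

`Δ = {0 ≤ w ≤ 1, 0 ≤ v ≤ 1 − w}`.  Fibrewise `∫₀^{1−w} dv/(1 + c w v) = log(1 + c·w(1−w))/(c w)`, and
`q(w) = 1 + c·w(1−w)` is symmetric under `w ↦ 1 − w`; cutting at `w = ½`, folding the right half onto the
left by `w ↦ 1 − w` and substituting `w = u/(1+u)` (so that `w(1−w) = u/(1+u)²`) turns `TΔ(c)` into the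
LINEAR-FIBRE box form `G(c)`, whose fibre integral is `log(((1+u)² + c u)/(1+u)²)/u`.  Every step is a
move of rule 1 or rule 2 (cuts, shifts, base charts `u ↦ 1/(1+u)`, `u ↦ u/(1+u)`, affine fibre maps). -/

end Summit.KontsevichZagierPeriods.RootDecompQuadraticDescent.GoldenPair

end
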